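import Mathlib
import HarnessLib
import Literature.Analysis.Calculus.SmoothCutoff
import Literature.Analysis.Calculus.LogCutoff
import Literature.Analysis.Calculus.SmoothTransitionDerivBound
import Literature.Analysis.Calculus.ExpNegInvGlueGevrey
import Literature.Analysis.FluidPDE.Wei2016HardyCutoff

/-!
# Route `KLProgramme` — crux C4a, S3 brick (B4) «(B4)-UMK1», «(M1)-FAMILY» part 7: A CONCRETE ADMISSIBLE SPLIT PROFILE `ppSplitProfile t₁`

Cell `gate-hubbard-kl`, seat hubbard-kl-k3c3-p1 (g16; row «δμ-flow with klAngularMean constant piece»).  The kernel family `ppFamilyKernel β Λ κ lo` and its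
one-call bundle `…PPKernelFamilyBundle.ppFamilyKernel_rows` take an abstract finer-line split profile `κ` with `HasDerivAt κ κ′`, `HasDerivAt κ′ κ″`, `κ″`
continuous, `|κ|,|κ′|,|κ″| ≤ κ₀,κ₁,κ₂` on `[0,1]`, `κ = κ′ = κ″ = 0` on `[t₁,∞)`.  This file supplies ONE such profile with EXPLICIT constants:
`ppSplitProfile t₁ t := S(2 − (2/t₁)·t)` (`S = Real.smoothTransition`): `C^∞`, `= 1` on `t ≤ t₁/2`, `= 0` on `t ≥ t₁`, `0 ≤ · ≤ 1`, `|κ′| ≤ 6/t₁`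
(`|S′| ≤ 3`, `…SmoothTransitionDerivBound`), `|κ″| ≤ 8388608/t₁²` (`|S″| ≤ 8·(2!)²·256²`, `…ExpNegInvGlueGevrey`; `S″ = 0` on `(−∞,0]` from `…Wei2016HardyCutoff`), and the packaged admissibility
**`ppSplitProfile_admissible`** in the bundle's hypothesis shapes (`κ₀ = 1`, `κ₁ = 6/t₁`, `κ₂ = 8388608/t₁²`).
Pure real analysis on a Mathlib function; nothing asserts (C), K3, the window or superconductivity.
References: Disertori–Rivasseau 2000 §II.2 [cite: DisertoriRivasseau2000]; FST II CPAM 51 (1998) §3 [cite: FeldmanSalmhoferTrubowitz1998].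
-/

noncomputable section

namespace Summit.HubbardSuperconductivity.HubbardSuperconductivity.Theorems.C4a

set_option linter.dupNamespace false -- summit = problem name (single-conjunct summit), D-0017

open Real Filter Set
open scoped Topology ContDiff
open Literature.Analysis.Calculus

/-! ## §1 The profile -/

/-- **The finer-line split profile at cut `t₁`**: `κ_{t₁}(t) = S(2 − (2/t₁)·t)` with `S = Real.smoothTransition`; equals `1` for `t ≤ t₁/2`,
`0` for `t ≥ t₁`, smooth and monotone in between. [cite: FeldmanSalmhoferTrubowitz1998, §3] -/
def ppSplitProfile (t₁ t : ℝ) : ℝ := Real.smoothTransition (2 - 2 / t₁ * t)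

/-- `κ_{t₁}(t) = 0` for `t ≥ t₁` (`0 < t₁`). [folklore] -/
theorem ppSplitProfile_eq_zero_of_le {t₁ t : ℝ} (ht₀ : 0 < t₁) (ht : t₁ ≤ t) : ppSplitProfile t₁ t = 0 := by
  unfold ppSplitProfile
  refine Real.smoothTransition.zero_of_nonpos ?_
  rw [sub_nonpos, div_mul_eq_mul_div, le_div_iff₀ ht₀]; linarith

/-- `κ_{t₁}(t) = 1` for `t ≤ t₁/2` (`0 < t₁`). [folklore] -/
theorem ppSplitProfile_eq_one_of_le {t₁ t : ℝ} (ht₀ : 0 < t₁) (ht : t ≤ t₁ / 2) : ppSplitProfile t₁ t = 1 := by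
  unfold ppSplitProfile
  refine Real.smoothTransition.one_of_one_le ?_
  rw [div_mul_eq_mul_div, le_sub_comm, div_le_iff₀ ht₀]; linarith

/-- `0 ≤ κ_{t₁}`. [folklore] -/
theorem ppSplitProfile_nonneg (t₁ t : ℝ) : 0 ≤ ppSplitProfile t₁ t := Real.smoothTransition.nonneg _

/-- `κ_{t₁} ≤ 1`. [folklore] -/
theorem ppSplitProfile_le_one (t₁ t : ℝ) : ppSplitProfile t₁ t ≤ 1 := Real.smoothTransition.le_one _

/-- `|κ_{t₁}| ≤ 1`. [folklore] -/
theorem abs_ppSplitProfile_le_one (t₁ t : ℝ) : |ppSplitProfile t₁ t| ≤ 1 := by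
  rw [abs_of_nonneg (ppSplitProfile_nonneg t₁ t)]; exact ppSplitProfile_le_one t₁ t

/-- `κ_{t₁}` is `C^∞`. [folklore] -/
theorem contDiff_ppSplitProfile (t₁ : ℝ) {n : ℕ∞} : ContDiff ℝ n (ppSplitProfile t₁) :=
  Real.smoothTransition.contDiff.comp (contDiff_const.sub (contDiff_const.mul contDiff_id))

/-! ## §2 Derivatives -/

/-- The inner affine map `t ↦ 2 − (2/t₁)t` has derivative `−2/t₁`. [folklore] -/
theorem hasDerivAt_splitInner (t₁ t : ℝ) : HasDerivAt (fun s : ℝ => 2 - 2 / t₁ * s) (-(2 / t₁)) t := by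
  simpa using ((hasDerivAt_id t).const_mul (2 / t₁)).const_sub 2

/-- `κ_{t₁}′(t) = −(2/t₁)·S′(2 − (2/t₁)t)`. [folklore] -/
theorem hasDerivAt_ppSplitProfile (t₁ t : ℝ) :
    HasDerivAt (ppSplitProfile t₁) (-(2 / t₁) * deriv Real.smoothTransition (2 - 2 / t₁ * t)) t := by
  have h := ((differentiable_smoothTransition _).hasDerivAt.comp t (hasDerivAt_splitInner t₁ t))
  have hf : (Real.smoothTransition ∘ fun s : ℝ => 2 - 2 / t₁ * s) = ppSplitProfile t₁ := rfl
  rw [hf] at h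
  exact h.congr_deriv (by ring)

/-- `deriv κ_{t₁}` in closed form. [folklore] -/
theorem deriv_ppSplitProfile (t₁ t : ℝ) : deriv (ppSplitProfile t₁) t = -(2 / t₁) * deriv Real.smoothTransition (2 - 2 / t₁ * t) :=
  (hasDerivAt_ppSplitProfile t₁ t).deriv

/-- `deriv κ_{t₁}` as a function. [folklore] -/
theorem deriv_ppSplitProfile_eq (t₁ : ℝ) : deriv (ppSplitProfile t₁) = fun t => -(2 / t₁) * deriv Real.smoothTransition (2 - 2 / t₁ * t) :=
  funext (deriv_ppSplitProfile t₁)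

/-- `κ_{t₁}″(t) = (2/t₁)²·S″(2 − (2/t₁)t)`. [folklore] -/
theorem hasDerivAt_deriv_ppSplitProfile (t₁ t : ℝ) :
    HasDerivAt (deriv (ppSplitProfile t₁)) ((2 / t₁) ^ 2 * deriv (deriv Real.smoothTransition) (2 - 2 / t₁ * t)) t := by
  rw [deriv_ppSplitProfile_eq]
  have hd : DifferentiableAt ℝ (deriv Real.smoothTransition) (2 - 2 / t₁ * t) :=
    (contDiff_deriv_smoothTransition.differentiable (by simp)).differentiableAt
  have h := (hd.hasDerivAt.comp t (hasDerivAt_splitInner t₁ t)).const_mul (-(2 / t₁))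
  exact h.congr_deriv (by ring)

/-- `deriv (deriv κ_{t₁})` in closed form. [folklore] -/
theorem deriv_deriv_ppSplitProfile (t₁ t : ℝ) :
    deriv (deriv (ppSplitProfile t₁)) t = (2 / t₁) ^ 2 * deriv (deriv Real.smoothTransition) (2 - 2 / t₁ * t) :=
  (hasDerivAt_deriv_ppSplitProfile t₁ t).deriv

/-- `κ_{t₁}″` is continuous. [folklore] -/
theorem continuous_deriv_deriv_ppSplitProfile (t₁ : ℝ) : Continuous (deriv (deriv (ppSplitProfile t₁))) := by
  have h : deriv (deriv (ppSplitProfile t₁)) = fun t => (2 / t₁) ^ 2 * deriv (deriv Real.smoothTransition) (2 - 2 / t₁ * t) :=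
    funext (deriv_deriv_ppSplitProfile t₁)
  rw [h]
  exact continuous_const.mul ((contDiff_deriv_smoothTransition.continuous_deriv (by simp)).comp (by fun_prop))

/-! ## §3 Vanishing on `[t₁, ∞)` -/

/-- `κ_{t₁}′(t) = 0` for `t ≥ t₁`. [folklore] -/
theorem deriv_ppSplitProfile_eq_zero_of_le {t₁ t : ℝ} (ht₀ : 0 < t₁) (ht : t₁ ≤ t) : deriv (ppSplitProfile t₁) t = 0 := by
  have hin : 2 - 2 / t₁ * t ≤ 0 := by rw [sub_nonpos, div_mul_eq_mul_div, le_div_iff₀ ht₀]; linarith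
  rw [deriv_ppSplitProfile, deriv_smoothTransition_of_nonpos hin, mul_zero]

/-- `κ_{t₁}″(t) = 0` for `t ≥ t₁`. [folklore] -/
theorem deriv_deriv_ppSplitProfile_eq_zero_of_le {t₁ t : ℝ} (ht₀ : 0 < t₁) (ht : t₁ ≤ t) : deriv (deriv (ppSplitProfile t₁)) t = 0 := by
  have hin : 2 - 2 / t₁ * t ≤ 0 := by rw [sub_nonpos, div_mul_eq_mul_div, le_div_iff₀ ht₀]; linarith
  rw [deriv_deriv_ppSplitProfile, Literature.Analysis.FluidPDE.Wei2016.deriv_deriv_smoothTransition_of_nonpos hin, mul_zero]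

/-! ## §4 Explicit bounds -/

/-- `|S″| ≤ 2097152 = 8·(2!)²·256²` everywhere (the tree's Gevrey numeral bound at `n = 2`). [cite: DisertoriRivasseau2000, §II.2 (II.14)] -/
theorem abs_deriv_deriv_smoothTransition_le (x : ℝ) : |deriv (deriv Real.smoothTransition) x| ≤ 2097152 := by
  have h := abs_iteratedDeriv_smoothTransition_le_numeral 2 x
  rw [iteratedDeriv_succ, iteratedDeriv_one] at h
  norm_num [Nat.factorial] at h
  exact h

/-- `|κ_{t₁}′| ≤ 6/t₁` (`0 < t₁`). [folklore] -/
theorem abs_deriv_ppSplitProfile_le {t₁ : ℝ} (ht₀ : 0 < t₁) (t : ℝ) : |deriv (ppSplitProfile t₁) t| ≤ 6 / t₁ := by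
  rw [deriv_ppSplitProfile, abs_mul, abs_neg, abs_of_pos (div_pos two_pos ht₀)]
  have h := abs_deriv_smoothTransition_le_three (2 - 2 / t₁ * t)
  calc 2 / t₁ * |deriv Real.smoothTransition (2 - 2 / t₁ * t)| ≤ 2 / t₁ * 3 := mul_le_mul_of_nonneg_left h (div_pos two_pos ht₀).le
    _ = 6 / t₁ := by ring

/-- `|κ_{t₁}″| ≤ 8388608/t₁²`. [folklore] -/
theorem abs_deriv_deriv_ppSplitProfile_le (t₁ t : ℝ) : |deriv (deriv (ppSplitProfile t₁)) t| ≤ 8388608 / t₁ ^ 2 := by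
  rw [deriv_deriv_ppSplitProfile, abs_mul, abs_of_nonneg (sq_nonneg _)]
  have h := abs_deriv_deriv_smoothTransition_le (2 - 2 / t₁ * t)
  calc (2 / t₁) ^ 2 * |deriv (deriv Real.smoothTransition) (2 - 2 / t₁ * t)| ≤ (2 / t₁) ^ 2 * 2097152 :=
        mul_le_mul_of_nonneg_left h (sq_nonneg _)
    _ = 8388608 / t₁ ^ 2 := by ring

/-! ## §5 Packaged admissibility (the bundle's hypothesis shapes) -/

/-- **`ppSplitProfile t₁` IS ADMISSIBLE SPLIT DATA** for `ppFamilyKernel` / `ppFamilyKernel_rows` with `κ := ppSplitProfile t₁`, `κ′ := deriv κ`,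
`κ″ := deriv (deriv κ)`, `κ₀ := 1`, `κ₁ := 6/t₁`, `κ₂ := 8388608/t₁²` (`0 < t₁`): the nine standing rows `hκ hκ′ hκ″c hκb hκ′b hκ″b hκs hκ′s hκ″s`
in that order. [cite: FeldmanSalmhoferTrubowitz1998, §3] -/
theorem ppSplitProfile_admissible {t₁ : ℝ} (ht₀ : 0 < t₁) :
    (∀ t, HasDerivAt (ppSplitProfile t₁) (deriv (ppSplitProfile t₁) t) t) ∧
    (∀ t, HasDerivAt (deriv (ppSplitProfile t₁)) (deriv (deriv (ppSplitProfile t₁)) t) t) ∧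
    Continuous (deriv (deriv (ppSplitProfile t₁))) ∧
    (∀ t ∈ Icc (0 : ℝ) 1, |ppSplitProfile t₁ t| ≤ 1) ∧
    (∀ t ∈ Icc (0 : ℝ) 1, |deriv (ppSplitProfile t₁) t| ≤ 6 / t₁) ∧
    (∀ t ∈ Icc (0 : ℝ) 1, |deriv (deriv (ppSplitProfile t₁)) t| ≤ 8388608 / t₁ ^ 2) ∧
    (∀ t, t₁ ≤ t → ppSplitProfile t₁ t = 0) ∧
    (∀ t, t₁ ≤ t → deriv (ppSplitProfile t₁) t = 0) ∧
    (∀ t, t₁ ≤ t → deriv (deriv (ppSplitProfile t₁)) t = 0) :=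
  ⟨fun t => (hasDerivAt_ppSplitProfile t₁ t).differentiableAt.hasDerivAt,
    fun t => (hasDerivAt_deriv_ppSplitProfile t₁ t).differentiableAt.hasDerivAt,
    continuous_deriv_deriv_ppSplitProfile t₁,
    fun t _ => abs_ppSplitProfile_le_one t₁ t,
    fun t _ => abs_deriv_ppSplitProfile_le ht₀ t,
    fun t _ => abs_deriv_deriv_ppSplitProfile_le t₁ t,
    fun _ ht => ppSplitProfile_eq_zero_of_le ht₀ ht,
    fun _ ht => deriv_ppSplitProfile_eq_zero_of_le ht₀ ht,
    fun _ ht => deriv_deriv_ppSplitProfile_eq_zero_of_le ht₀ ht⟩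

end Summit.HubbardSuperconductivity.HubbardSuperconductivity.Theorems.C4a

end
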